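import Mathlib
import Summits.KontsevichZagierPeriods.Zeta5Search.BrickDigitStepD
import Summits.KontsevichZagierPeriods.Zeta5Search.BrickHarmonicBlocks
import Summits.KontsevichZagierPeriods.Zeta5Search.BrickPartialFractions

/-!
# BrickDigitStepDZero — THEOREM 5/6 Step D for the CONSTANT-TERM CELL `s = 0` ((D2)):
`D_j^{(0)} ≡ p^{Lτ_0}·(Φ(−j) − 1)·cell_j^{(0)}(n) (mod p³)`, `cell^{(0)}_j = −Σ_s c_{j,s}H_j^{(s)}`, `τ_0 = A − 1`
(cell zeta5-irr)

HONEST FRAMING: systematic search; no irrationality claim unless certified. INSTRUMENT lemma of the ζ(5)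
census cell zeta5-irr (HOME `run/shared/lean/pub/zeta5-irr/`; memo `zi-p2/probes/B8/thm6/THEOREM6.md` Step D:
«For `s = 0`, exactly as THEOREM 5 (D2) [(B1), (B2); (i) `v(p^{A−1}φ_mc_{j,s+m}H_j^{(s)}) ≥ 2 + m + ṽ_j ≥ 3` for
`m ≥ 1`; (ii) `v(p^{A−1}c_{j,s}·p^sV_s(jp)) ≥ … ≥ s + 2 ≥ 3`]: `D_j^{(0)} ≡ p^{τ_0}(Φ(−j)−1)·cell_j^{(0)}(n) (mod p³)`»).
Nothing here is about ζ(5); no irrationality content; filing moves no rung. Filed by the engine seat zi-eng (g8):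
assembly of `BrickLaurent.cell_frobenius` ((B1) for every `s`), `BrickHarmonicBlocks` ((B2)),
`BrickPhiCoeff` ((A2)) and `BrickTopKummer.cell_one_valuation_abs` ((C3⁺)).

## The statement

`p ≥ 5` prime, `2B ≤ A`, `1 ≤ A`, level `L` (`n < p^{L+1}`), `j ≤ n`; `cellZero A B 1 m K = −Σ_{s=1}^{A} c_{K,s}(m)·H_K^{(s)}`
(`BrickPartialFractions`), `φ_0 = Φ_{n,p}(−j)`. With
`digitDZero A B p L n j := p^{L(A−1)}·(p^{A−1}·cellZero(np, jp) − cellZero(n, j))`: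

**`v(digitDZero − p^{L(A−1)}·(φ_0 − 1)·cellZero A B 1 n j) ≤ exp(−3)`** (`digitDZero_sub_le`).
Ingredients: `hsum_valuation` (`v_p(H_j^{(s)}) ≥ −Ls` for `j < p^{L+1}`), the termwise identity `cellZero_term`
(`p^{A−1}c_{jp,s}(np)H_{jp}^{(s)} = [Σ_m φ_m c_{j,s+m}(n)]·[H_j^{(s)} + p^sV_s(jp)]`).
-/

namespace Summit.KontsevichZagierPeriods.Zeta5Search.BrickDigitStepDZero

open Finset Nat WithZero
open Summit.KontsevichZagierPeriods.Zeta5Search.BrickLaurent (cell phiCoeff cell_frobenius)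
open Summit.KontsevichZagierPeriods.Zeta5Search.BrickPartialFractions (cellZero)
open Summit.KontsevichZagierPeriods.Zeta5Search.BrickHarmonicBlocks (hsum blockSigma pow_mul_hsum_mul
  padicValuation_pow_mul_blockSum_le)
open Summit.KontsevichZagierPeriods.Zeta5Search.BrickPhiCoeff (padicValuation_phiCoeff_le isSlopeInt_phiSeries)
open Summit.KontsevichZagierPeriods.Zeta5Search.BrickTopKummer (cell_one_valuation_abs)
open Summit.KontsevichZagierPeriods.Zeta5Search.BrickCellValuation (padicValNat_le_of_lt_pow)
open Literature.NumberTheory.LFunctions (padicValuation_natCast_le_one)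

noncomputable section

variable {p : ℕ} [Fact p.Prime]

/-- The level-`L` constant-term digit difference `D_j^{(0),L} := p^{L(A−1)}·(p^{A−1}·cell^{(0)}_{jp}(np) − cell^{(0)}_j(n))`. -/
def digitDZero (A B p L n j : ℕ) : ℚ :=
  (p : ℚ) ^ (L * (A - 1)) * ((p : ℚ) ^ (A - 1) * cellZero A B 1 (n * p) (j * p) - cellZero A B 1 n j)

omit [Fact p.Prime] in
/-- `cell^{(0)}_K(m) = −Σ_{s=1}^{A} c_{K,s}(m)·H_K^{(s)}` in terms of `hsum`. -/
theorem cellZero_eq (A B ε m K : ℕ) : cellZero A B ε m K = -∑ s ∈ Icc 1 A, cell A B ε m K s * hsum s K := rfl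

/-- `v_p(H_j^{(s)}) ≥ −L·s` for `j < p^{L+1}`. -/
theorem hsum_valuation {L j : ℕ} (hj : j < p ^ (L + 1)) (s : ℕ) :
    Rat.padicValuation p (hsum s j) ≤ exp ((L : ℤ) * s) := by
  refine Valuation.map_sum_le _ fun i hi => ?_
  have hi' := mem_Icc.1 hi
  have hv : padicValNat p i ≤ L := padicValNat_le_of_lt_pow (by omega) (by omega)
  rw [one_div, map_inv₀, map_pow, BrickLaurentValuation.padicValuation_natCast (by omega), ← exp_nsmul, ← exp_neg,
    exp_le_exp]
  simp only [nsmul_eq_mul, mul_neg, neg_neg]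
  have hv' : (padicValNat p i : ℤ) ≤ L := by exact_mod_cast hv
  nlinarith [Int.natCast_nonneg s]

section stepD0

variable (h3 : 3 < p) {A B : ℕ} (hAB : 2 * B ≤ A) (hA : 1 ≤ A) {L n j : ℕ} (hn : n < p ^ (L + 1)) (hj : j ≤ n)
include h3 hAB hA hj

/-- The termwise identity: `p^{A−1}·c_{jp,s}(np)·H_{jp}^{(s)} = [Σ_{m≤A−s} φ_m c_{j,s+m}(n)]·[H_j^{(s)} + p^s V_s(jp)]`
(`s ≤ A`). -/
theorem cellZero_term {s : ℕ} (hsA : s ≤ A) :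
    (p : ℚ) ^ (A - 1) * (cell A B 1 (n * p) (j * p) s * hsum s (j * p)) =
      (∑ m ∈ range (A - s + 1), phiCoeff A B p n j m * cell A B 1 n j (s + m)) *
        (hsum s j + (p : ℚ) ^ s * ∑ b ∈ range j, blockSigma p s b) := by
  have hp : p.Prime := Fact.out
  have hpQ : (p : ℚ) ≠ 0 := by exact_mod_cast hp.ne_zero
  have h := cell_frobenius hp (by omega) hAB 1 hj s
  rw [pow_one] at h
  rw [← pow_mul_hsum_mul]
  -- `p^{A−1}·c·H = (p^{A−s}·c)·(p^s·H)/p`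
  have e : (p : ℚ) ^ (A - 1) * (cell A B 1 (n * p) (j * p) s * hsum s (j * p)) =
      ((p : ℚ) ^ (A - s) * cell A B 1 (n * p) (j * p) s) * ((p : ℚ) ^ s * hsum s (j * p)) / p := by
    rw [eq_div_iff hpQ, show (p : ℚ) ^ (A - 1) * (cell A B 1 (n * p) (j * p) s * hsum s (j * p)) * p =
      ((p : ℚ) ^ (A - 1) * p) * (cell A B 1 (n * p) (j * p) s * hsum s (j * p)) by ring, ← pow_succ,
      show A - 1 + 1 = (A - s) + s by omega, pow_add]
    ring
  rw [e, h]
  field_simp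

include hn

/-- **(D2) at level `L`**: `v_p(D_j^{(0)} − p^{L(A−1)}(φ_0 − 1)·cell^{(0)}_j(n)) ≥ 3`. -/
theorem digitDZero_sub_le :
    Rat.padicValuation p (digitDZero A B p L n j -
      (p : ℚ) ^ (L * (A - 1)) * (phiCoeff A B p n j 0 - 1) * cellZero A B 1 n j) ≤ exp (-3) := by
  have hp : p.Prime := Fact.out
  have hp2 : p ≠ 2 := by omega
  have hjlt : j < p ^ (L + 1) := lt_of_le_of_lt hj hn
  set P : ℚ := (p : ℚ) ^ (L * (A - 1)) with hP
  set φ₀ : ℚ := phiCoeff A B p n j 0 with hφ₀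
  -- notation for the slices
  set M : ℕ → ℚ := fun s => ∑ m ∈ range (A - s + 1), phiCoeff A B p n j m * cell A B 1 n j (s + m) with hM
  set tail : ℕ → ℚ := fun s => ∑ m ∈ range (A - s), phiCoeff A B p n j (m + 1) * cell A B 1 n j (s + (m + 1)) with htail
  set V : ℕ → ℚ := fun s => (p : ℚ) ^ s * ∑ b ∈ range j, blockSigma p s b with hV
  set slice : ℕ → ℚ := fun s => (P * (p : ℚ) ^ (A - 1)) * (cell A B 1 (n * p) (j * p) s * hsum s (j * p)) -
    (P * φ₀) * (cell A B 1 n j s * hsum s j) with hslice_def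
  -- the global rearrangement
  have hG : digitDZero A B p L n j - P * (φ₀ - 1) * cellZero A B 1 n j = -∑ s ∈ Icc 1 A, slice s := by
    simp only [hslice_def]
    rw [Finset.sum_sub_distrib, ← Finset.mul_sum, ← Finset.mul_sum, digitDZero, cellZero_eq, cellZero_eq, ← hP]
    ring
  -- the slices
  have hslice : ∀ s ∈ Icc 1 A, slice s = P * (tail s * hsum s j + M s * V s) := by
    intro s hs
    have hs' := mem_Icc.1 hs
    have hMs : M s = tail s + φ₀ * cell A B 1 n j s := by
      simp only [hM, htail]
      rw [Finset.sum_range_succ', add_zero]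
    have key : (p : ℚ) ^ (A - 1) * (cell A B 1 (n * p) (j * p) s * hsum s (j * p)) = M s * (hsum s j + V s) :=
      cellZero_term h3 hAB hA hj hs'.2
    simp only [hslice_def]
    rw [mul_assoc P, key, hMs]
    ring
  rw [hG, Valuation.map_neg]
  refine Valuation.map_sum_le _ fun s hs => ?_
  have hs' := mem_Icc.1 hs
  -- bounds on the pieces
  have hH : Rat.padicValuation p (hsum s j) ≤ exp ((L : ℤ) * s) := hsum_valuation hjlt s
  have hφ : ∀ m, Rat.padicValuation p (phiCoeff A B p n j m) ≤ 1 := fun m => by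
    rw [phiCoeff]
    simpa using isSlopeInt_phiSeries (p := p) h3 A B n (j : ℤ) m
  have hc : ∀ s', Rat.padicValuation p (cell A B 1 n j s') ≤ exp ((L : ℤ) * (A - s' : ℕ)) := fun s' =>
    cell_one_valuation_abs hp2 hAB hn hj s'
  have htailv : Rat.padicValuation p (tail s) ≤ exp (-3 + (L : ℤ) * ((A : ℤ) - s - 1)) := by
    refine Valuation.map_sum_le _ fun m hm => ?_
    have hm' := mem_range.1 hm
    rw [map_mul]
    calc _ ≤ exp (-3) * exp ((L : ℤ) * (A - (s + (m + 1)) : ℕ)) :=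
          mul_le_mul' (padicValuation_phiCoeff_le h3 hAB n j (by omega)) (hc _)
      _ ≤ _ := by
          rw [← exp_add, exp_le_exp, Nat.cast_sub (by omega : s + (m + 1) ≤ A)]
          push_cast
          nlinarith [mul_nonneg (Int.natCast_nonneg L) (Int.natCast_nonneg m)]
  have hMv : Rat.padicValuation p (M s) ≤ exp ((L : ℤ) * ((A : ℤ) - s)) := by
    refine Valuation.map_sum_le _ fun m hm => ?_
    have hm' := mem_range.1 hm
    rw [map_mul]
    calc _ ≤ 1 * exp ((L : ℤ) * (A - (s + m) : ℕ)) := mul_le_mul' (hφ m) (hc _)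
      _ ≤ _ := by
          rw [one_mul, exp_le_exp, Nat.cast_sub (by omega : s + m ≤ A)]
          push_cast
          nlinarith [mul_nonneg (Int.natCast_nonneg L) (Int.natCast_nonneg m)]
  have hVv : Rat.padicValuation p (V s) ≤ exp (-3) := padicValuation_pow_mul_blockSum_le h3 hs'.1 j
  have hPv : Rat.padicValuation p P = exp (-((L * (A - 1) : ℕ) : ℤ)) := by
    rw [hP, map_pow, Rat.padicValuation_self, ← exp_nsmul, nsmul_eq_mul, mul_neg_one]
  have hs1 : (1 : ℤ) ≤ s := by exact_mod_cast hs'.1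
  rw [hslice s hs, mul_add]
  refine Valuation.map_add_le _ ?_ ?_
  · rw [map_mul, map_mul, hPv]
    calc _ ≤ exp (-((L * (A - 1) : ℕ) : ℤ)) * (exp (-3 + (L : ℤ) * ((A : ℤ) - s - 1)) * exp ((L : ℤ) * s)) :=
          mul_le_mul' le_rfl (mul_le_mul' htailv hH)
      _ ≤ exp (-3) := by
          rw [← exp_add, ← exp_add, exp_le_exp, Nat.cast_mul, Nat.cast_sub hA]
          push_cast
          nlinarith [Int.natCast_nonneg L]
  · rw [map_mul, map_mul, hPv]
    calc _ ≤ exp (-((L * (A - 1) : ℕ) : ℤ)) * (exp ((L : ℤ) * ((A : ℤ) - s)) * exp (-3)) :=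
          mul_le_mul' le_rfl (mul_le_mul' hMv hVv)
      _ ≤ exp (-3) := by
          rw [← exp_add, ← exp_add, exp_le_exp, Nat.cast_mul, Nat.cast_sub hA]
          push_cast
          nlinarith [mul_nonneg (Int.natCast_nonneg L) (sub_nonneg.2 hs1)]

end stepD0

end

end Summit.KontsevichZagierPeriods.Zeta5Search.BrickDigitStepDZero
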